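import Mathlib
import Literature.Analysis.FluidPDE.NSViscosityRescaling
import Literature.Analysis.FluidPDE.KNSSTypeIIHolds
import Literature.Analysis.FluidPDE.MollifiedSliceTools
import Literature.Analysis.FluidPDE.NSCriticalClosureBesovBounded
import Literature.Analysis.FluidPDE.TaoLocalisationHolds
import Summits.NavierStokesRegularity.NavierStokesRegularity.Theorems.PlaneEnergyCeilingBoundedPlanarEnergyRegularityZoomLimit
import Summits.NavierStokesRegularity.NavierStokesRegularity.Theorems.PlaneEnergyCeilingBoundedPlanarEnergyRegularityZoomOseenLimit
import Summits.NavierStokesRegularity.NavierStokesRegularity.Theorems.DSolutionBubbleTypeIISlowDoublingEternalExtraction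
import Summits.NavierStokesRegularity.NavierStokesRegularity.Theorems.DSolutionBubbleTypeIISlowDoublingEternalCells
import Summits.NavierStokesRegularity.NavierStokesRegularity.Theses.DSolutionBubble
import HarnessLib

/-!
# `DSolutionBubble.TypeIISlowDoublingEternal` — Type II ⇒ bounded ETERNAL zoom limit
  (item stmt-NavierStokesRegularity-4064)

**Statement.** `ν > 0`, `T > 0`, `(u, p)` a MAXIMAL classical solution on `ℝ³ × [0, T)`, Leray–Hopf
on `[0, T]` from a rapidly decaying datum, NOT of Type I at `T`. Then there is
`w : ℝ → ℝ³ → ℝ³`, jointly `C^∞` on `ℝ × ℝ³`, every time-shift of which is a bounded ancient mild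
solution (`ν = 1`, duality form) — a bounded ETERNAL mild solution — with `‖w‖ ≤ 1` for `s ≤ 0`,
`‖w‖ ≤ 2` everywhere and `‖w(0, 0)‖ = 1`.

PROOF (KNSS 2009 §6 zoom with Poláčik–Quittner–Souplet point picking).
1. Normalise `ν = 1` (`w₁(s) = ν⁻¹u(s/ν)` on `(0, νT)`, `IsClassicalNSSolutionOn.viscosityRescale_set`);
   `w₁` is bounded on every `[0, T'] × ℝ³`, `T' < νT` (Tao, `exists_forall_norm_le_of_tao2011`),
   slices uniformly in `L²`; `w₁(0, ·) ≢ 0` (else `u ≡ 0` by the energy inequality and `u` extends,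
   `hasSmoothExtensionPast_of_bounded_holds`); failure of the Type-I rate reads
   `‖w₁(τ, x)‖² (νT − τ)` unbounded near `νT`.
2. SLOW-DOUBLING CELLS (tools `TypeIISlowDoublingEternal.exists_slowDoubling_cells`, the doubling
   lemma of Poláčik–Quittner–Souplet applied to the running supremum): centres `(t'_j, x_j)`,
   `N_j = ‖w₁(t'_j, x_j)‖`, with `‖w₁‖ ≤ (1 + 1/(j+5)) N_j` on `[0, t'_j]`, `‖w₁‖ ≤ 2N_j` on
   `[0, t'_j + ℓ_j]`, and rescaled lengths `t'_j N_j², ℓ_j N_j² ≥ j + 2`.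
3. The KNSS rescaling `V_j(s, y) = N_j⁻¹ w₁(t'_j + s/N_j², x_j + y/N_j)` is classical on the
   two-sided window `(A_j, B_j)`, `A_j ≤ −(j+2)`, `B_j ≥ j+2`, bounded by `2`, by `1 + 1/(j+5)` on
   `(A_j, 0]`, `‖V_j(0, 0)‖ = 1`, with square-integrable slices uniformly in `L²` (scaling).
4. ETERNAL EXTRACTION (tools `TypeIISlowDoublingEternal.exists_eternal_limit`,
   `TypeIISlowDoublingEternal.eternal_of_oseen`): a subsequence converges pointwise on `ℝ × ℝ³` to a
   continuous `w`, `‖w‖ ≤ 2`, with the Oseen identity between all `s < t`; every shift is a bounded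
   ancient mild solution and `w ∈ C^∞`; `‖w‖ ≤ 1` on `s ≤ 0` and `‖w(0,0)‖ = 1` pass to the limit.

HONEST FRAMING: a compactness lemma about HYPOTHETICAL Type-II blow-up solutions (other route,
not a pub-ns-dss cell file); the limit may well be a constant ("ballistic residual"); nothing here
bears on the regularity problem itself.

References: Koch–Nadirashvili–Seregin–Šverák 2009, §6 (arXiv:0709.3599 pp. 11–12);
Poláčik–Quittner–Souplet 2007, Lemma 5.1; Seregin–Šverák 2009. [KochNadirashviliSereginSverak2009]
[PolacikQuittnerSouplet2007] [SereginSverak2009]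
-/

noncomputable section

set_option linter.dupNamespace false

namespace Summit.NavierStokesRegularity.NavierStokesRegularity.Theorems

open MeasureTheory Set Function Filter Topology TopologicalSpace Metric
open scoped NNReal ENNReal ContDiff
open Literature.Analysis Literature.Analysis.FluidPDE

open TypeIISlowDoublingEternal in
/-- **`DSolutionBubble.TypeIISlowDoublingEternal`** (item stmt-NavierStokesRegularity-4064, module
docstring): Type II ⇒ bounded ETERNAL zoom limit. [cite: KochNadirashviliSereginSverak2009, §6 (6.2)–(6.3), Lemma 6.1 (arXiv:0709.3599 pp. 11–12)] -/
theorem dSolutionBubble_typeIISlowDoublingEternal_proof :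
    Theses.DSolutionBubble.TypeIISlowDoublingEternal := by
  intro ν T hν hT u p hmax hLH hdec hnotI
  have hcl : IsClassicalNSSolutionOn (Ico 0 T) ν 0 u p := hmax.1
  have hne : ¬ HasSmoothExtensionPast ν 0 u T := hmax.2
  have hν' : 0 < ν⁻¹ := inv_pos.2 hν
  have hνT : 0 < ν * T := mul_pos hν hT
  have hu₀2 : MemLp (u 0) 2 volume := hLH.memLp 0 ⟨le_rfl, hT.le⟩
  obtain ⟨C₀, hC₀⟩ := hdec 0 0
  have hC₀' : ∀ x, ‖u 0 x‖ ≤ C₀ := fun x => by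
    have h1 := hC₀ x
    rwa [pow_zero, one_mul, norm_iteratedFDeriv_zero] at h1
  -- adapted from `BoundedPlanarEnergyRegularity.stub_planarEnergyZoom`
  -- (Theorems/PlaneEnergyCeilingBoundedPlanarEnergyRegularityStubPlanarEnergyZoom.lean), Steps 1–2
  -- ### Step 1: normalise the viscosity to `1`
  set w : ℝ → EuclideanSpace ℝ (Fin 3) → EuclideanSpace ℝ (Fin 3) := timeRescale ν⁻¹ ν⁻¹ u
    with hwdef
  set q : ℝ → EuclideanSpace ℝ (Fin 3) → ℝ := timeRescale ν⁻¹ (ν⁻¹ ^ 2) p with hqdef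
  have hmaps : MapsTo (fun s => ν⁻¹ * s) (Ioo 0 (ν * T)) (Ioo 0 T) := fun s hs =>
    (inv_mul_mem_Ioo_iff hν).2 hs
  have hclw : IsClassicalNSSolutionOn (Ioo 0 (ν * T)) 1 0 w q := by
    have h1 := (hcl.mono Ioo_subset_Ico_self (uniqueDiffOn_Ioo 0 T)).viscosityRescale_set hν.ne'
      hmaps (uniqueDiffOn_Ioo 0 (ν * T))
    simpa only [timeRescale_zero_force] using h1
  have hw_apply : ∀ s x, w s x = ν⁻¹ • u (ν⁻¹ * s) x := fun s x => rfl
  have hw_norm : ∀ s x, ‖w s x‖ = ν⁻¹ * ‖u (ν⁻¹ * s) x‖ := fun s x => by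
    rw [hw_apply, norm_smul, Real.norm_eq_abs, abs_of_pos hν']
  -- ### Step 2: bounded before `νT` (including time `0`), slices uniformly in `L²`
  have hbddw : ∀ T' < ν * T, ∃ M₁ : ℝ, ∀ s ∈ Ioo 0 T', ∀ x, ‖w s x‖ ≤ M₁ := by
    intro T' hT'
    rcases le_or_gt T' 0 with hT'0 | hT'0
    · exact ⟨0, fun s hs _ => absurd (hs.1.trans hs.2) (not_lt.2 hT'0)⟩
    · have hT₁ : ν⁻¹ * T' ∈ Ioo 0 T := (inv_mul_mem_Ioo_iff hν).2 ⟨hT'0, hT'⟩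
      obtain ⟨M₁, hM₁⟩ := exists_forall_norm_le_of_tao2011 tao2011_hasBoundedSobolevNormsOn_holds hν
        hcl hLH hdec (ν⁻¹ * T') hT₁
      refine ⟨ν⁻¹ * M₁, fun s hs x => ?_⟩
      rw [hw_norm]
      refine mul_le_mul_of_nonneg_left (hM₁ _ ⟨?_, ?_⟩ x) hν'.le
      · exact mul_nonneg hν'.le hs.1.le
      · exact mul_le_mul_of_nonneg_left hs.2.le hν'.le
  have hbddw' : ∀ T' < ν * T, ∃ Mb : ℝ, ∀ σ ∈ Icc (0 : ℝ) T', ∀ y, ‖w σ y‖ ≤ Mb := by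
    intro T' hT'
    obtain ⟨M₁, hM₁⟩ := hbddw ((T' + ν * T) / 2) (by linarith)
    refine ⟨max M₁ (ν⁻¹ * C₀), fun σ hσ y => ?_⟩
    rcases hσ.1.eq_or_lt with h0 | h0
    · rw [← h0, hw_norm, mul_zero]
      exact (mul_le_mul_of_nonneg_left (hC₀' y) hν'.le).trans (le_max_right _ _)
    · exact (hM₁ σ ⟨h0, by linarith [hσ.2]⟩ y).trans (le_max_left _ _)
  have hmem_u : ∀ s ∈ Ioo 0 (ν * T), ν⁻¹ * s ∈ Icc 0 T := fun s hs =>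
    ⟨(hmaps hs).1.le, (hmaps hs).2.le⟩
  have hL2w : ∀ s ∈ Ioo 0 (ν * T), MemLp (w s) 2 volume := fun s hs =>
    (hLH.memLp _ (hmem_u s hs)).const_smul ν⁻¹
  set K₀ : ℝ≥0∞ := ENNReal.ofReal ν⁻¹ * eLpNorm (u 0) 2 volume with hK₀
  have hK₀top : K₀ ≠ ⊤ := ENNReal.mul_ne_top ENNReal.ofReal_ne_top hu₀2.eLpNorm_ne_top
  have hK₀b : ∀ s ∈ Ioo 0 (ν * T), eLpNorm (w s) 2 volume ≤ K₀ := by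
    intro s hs
    have h1 : w s = ν⁻¹ • u (ν⁻¹ * s) := rfl
    rw [h1, eLpNorm_const_smul, Real.enorm_eq_ofReal hν'.le, hK₀]
    gcongr
    exact hLH.eLpNorm_le_eLpNorm_datum hν.le hu₀2 (hmem_u s hs)
  set T₁ : ℝ := ν * T with hT₁
  have hT₁pos : 0 < T₁ := hνT
  -- ### Step 3: the datum is not zero (else `u ≡ 0` extends past `T`)
  have hnz : ∃ y₀, w 0 y₀ ≠ 0 := by
    by_contra hall
    push Not at hall
    have hu0 : u 0 = 0 := by
      funext y
      have h1 : ν⁻¹ • u (ν⁻¹ * 0) y = 0 := by rw [← hw_apply]; exact hall y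
      rw [mul_zero] at h1
      exact (smul_eq_zero.1 h1).resolve_left hν'.ne'
    apply hne
    refine hasSmoothExtensionPast_of_bounded_holds hν hT hcl hLH ⟨0, fun t ht x => ?_⟩
    have hs : t ∈ Icc 0 T := ⟨ht.1, ht.2.le⟩
    have h1 : eLpNorm (u t) 2 volume ≤ eLpNorm (u 0) 2 volume :=
      hLH.eLpNorm_le_eLpNorm_datum hν.le hu₀2 hs
    rw [hu0] at h1
    have h2 : eLpNorm (u t) 2 volume = 0 :=
      le_antisymm (h1.trans (by simp)) bot_le
    have hcont : Continuous (u t) := (hcl.contDiff_velocity ht).continuous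
    have h3 : u t =ᵐ[volume] 0 :=
      (eLpNorm_eq_zero_iff hcont.aestronglyMeasurable two_ne_zero).1 h2
    have h4 : u t = 0 := (Continuous.ae_eq_iff_eq volume hcont continuous_const).1 h3
    simp [h4]
  -- ### Step 4: the failure of the Type-I rate, in the normalised variables
  have hnotIw : ∀ C : ℝ, ∀ τ₁ < T₁, ∃ τ ∈ Ioo τ₁ T₁, 0 ≤ τ ∧
      ∃ x : EuclideanSpace ℝ (Fin 3), C < ‖w τ x‖ ^ 2 * (T₁ - τ) := by
    intro C τ₁ hτ₁
    set Cu : ℝ := Real.sqrt (ν * (max C 0 + 1)) with hCu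
    have hCu0 : 0 ≤ Cu := Real.sqrt_nonneg _
    have hCusq : Cu ^ 2 = ν * (max C 0 + 1) := Real.sq_sqrt (by positivity)
    have hfreq : ∃ᶠ t in 𝓝[<] T, ∃ x, Cu / Real.sqrt (T - t) < ‖u t x‖ := by
      have h1 : ¬ ∀ᶠ t in 𝓝[<] T, ∀ x, ‖u t x‖ ≤ Cu / Real.sqrt (T - t) :=
        fun h => hnotI ⟨Cu, h⟩
      rw [not_eventually] at h1
      refine h1.mono fun t ht => ?_
      push Not at ht
      exact ht
    set a : ℝ := max (ν⁻¹ * τ₁) 0 with ha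
    have haT : a < T := max_lt (by rw [inv_mul_lt_iff₀ hν]; exact hτ₁) hT
    obtain ⟨t, ⟨x, hx⟩, hta⟩ := (hfreq.and_eventually (Ioo_mem_nhdsLT haT)).exists
    have ht0 : 0 ≤ t := (le_max_right _ _).trans hta.1.le
    have hTt : 0 < T - t := sub_pos.2 hta.2
    refine ⟨ν * t, ⟨?_, mul_lt_mul_of_pos_left hta.2 hν⟩, mul_nonneg hν.le ht0, x, ?_⟩
    · have h1 : ν⁻¹ * τ₁ < t := (le_max_left _ _).trans_lt hta.1
      rwa [inv_mul_lt_iff₀ hν] at h1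
    · have hs : 0 < Real.sqrt (T - t) := Real.sqrt_pos.2 hTt
      have h1 : Cu < ‖u t x‖ * Real.sqrt (T - t) := by rwa [div_lt_iff₀ hs] at hx
      have h2 : Cu ^ 2 < (‖u t x‖ * Real.sqrt (T - t)) ^ 2 := pow_lt_pow_left₀ h1 hCu0 two_ne_zero
      rw [mul_pow, Real.sq_sqrt hTt.le, hCusq] at h2
      rw [hw_norm, ← mul_assoc, inv_mul_cancel₀ hν.ne', one_mul, hT₁]
      have h3 : (ν⁻¹ * ‖u t x‖) ^ 2 * (ν * T - ν * t) = ν⁻¹ * (‖u t x‖ ^ 2 * (T - t)) := by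
        field_simp
      rw [h3]
      have h4 : max C 0 + 1 < ν⁻¹ * (‖u t x‖ ^ 2 * (T - t)) := by
        rw [lt_inv_mul_iff₀ hν]; linarith
      linarith [le_max_left C 0]
  -- ### Step 5: slow-doubling cells (tools) at levels `j + 2`
  have hcells := fun j : ℕ => exists_slowDoubling_cells hT₁pos hbddw' hnz hnotIw (j + 2)
  choose t' ℓ xc ht'0 hℓpos hℓT hNpos hpast hwin hℓN ht'N using hcells
  -- the scales
  obtain ⟨N, hN⟩ : ∃ N : ℕ → ℝ, ∀ j, N j = ‖w (t' j) (xc j)‖ := ⟨_, fun _ => rfl⟩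
  have hNp : ∀ j, 0 < N j := fun j => by rw [hN]; exact hNpos j
  set c : ℕ → ℝ := fun j => (N j)⁻¹ with hcdef
  have hcpos : ∀ j, 0 < c j := fun j => inv_pos.2 (hNp j)
  have hcN : ∀ j, c j * N j = 1 := fun j => inv_mul_cancel₀ (hNp j).ne'
  have hc2 : ∀ j, c j ^ 2 * N j ^ 2 = 1 := fun j => by rw [← mul_pow, hcN, one_pow]
  set A : ℕ → ℝ := fun j => -(t' j / c j ^ 2) with hAdef
  set B : ℕ → ℝ := fun j => ℓ j / c j ^ 2 with hBdef
  have hA_eq : ∀ j, A j = -(t' j * N j ^ 2) := fun j => by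
    simp only [hAdef, hcdef, inv_pow, div_inv_eq_mul]
  have hB_eq : ∀ j, B j = ℓ j * N j ^ 2 := fun j => by
    simp only [hBdef, hcdef, inv_pow, div_inv_eq_mul]
  have hjcast : ∀ j : ℕ, ((j + 2 : ℕ) : ℝ) = (j : ℝ) + 2 := fun j => by push_cast; ring
  have hAle : ∀ j, A j ≤ -((j : ℝ) + 2) := fun j => by
    rw [hA_eq, neg_le_neg_iff, ← hjcast]
    have := ht'N j; rw [← hN] at this; exact this
  have hBge : ∀ j : ℕ, (j : ℝ) + 2 ≤ B j := fun j => by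
    rw [hB_eq, ← hjcast]
    have := hℓN j; rw [← hN] at this; exact this
  have hAB : ∀ j, A j + 2 ≤ B j := fun j => by
    have := hAle j; have := hBge j; have := j.cast_nonneg (α := ℝ); linarith
  have hAtend : Tendsto A atTop atBot := by
    refine tendsto_atBot_mono hAle (tendsto_neg_atTop_atBot.comp ?_)
    exact tendsto_natCast_atTop_atTop.atTop_add tendsto_const_nhds
  have hBtend : Tendsto B atTop atTop :=
    tendsto_atTop_mono hBge (tendsto_natCast_atTop_atTop.atTop_add tendsto_const_nhds)
  -- the rescaled solutions
  obtain ⟨V, hV⟩ : ∃ V : ℕ → ℝ → EuclideanSpace ℝ (Fin 3) → EuclideanSpace ℝ (Fin 3),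
      ∀ j, V j = c j • stPull (c j ^ 2) (c j) (t' j) (xc j) w := ⟨_, fun _ => rfl⟩
  obtain ⟨P, hP⟩ : ∃ P : ℕ → ℝ → EuclideanSpace ℝ (Fin 3) → ℝ,
      ∀ j, P j = c j ^ 2 • stPull (c j ^ 2) (c j) (t' j) (xc j) q := ⟨_, fun _ => rfl⟩
  have hphys : ∀ j, ∀ s ∈ Ioo (A j) (B j), t' j + c j ^ 2 * s ∈ Ioo 0 (t' j + ℓ j) := by
    intro j s hs
    have hc2p : 0 < c j ^ 2 := pow_pos (hcpos j) 2
    have hcj : c j ≠ 0 := (hcpos j).ne'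
    constructor
    · have h1 : c j ^ 2 * A j < c j ^ 2 * s := mul_lt_mul_of_pos_left hs.1 hc2p
      have h2 : c j ^ 2 * A j = -(t' j) := by
        simp only [hAdef]; field_simp
      linarith
    · have h1 : c j ^ 2 * s < c j ^ 2 * B j := mul_lt_mul_of_pos_left hs.2 hc2p
      have h2 : c j ^ 2 * B j = ℓ j := by
        simp only [hBdef]; field_simp
      linarith
  have hphysT : ∀ j, ∀ s ∈ Ioo (A j) (B j), t' j + c j ^ 2 * s ∈ Ioo 0 T₁ := fun j s hs =>
    ⟨(hphys j s hs).1, (hphys j s hs).2.trans (hℓT j)⟩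
  have hVcl : ∀ j, IsClassicalNSSolutionOn (Ioo (A j) (B j)) 1 0 (V j) (P j) := fun j => by
    rw [hV j, hP j]
    exact (hclw.nsRescale_translate_zero (hcpos j) (t' j) (xc j)).mono
      (fun s hs => hphysT j s hs) (uniqueDiffOn_Ioo _ _)
  have hVapply : ∀ j s y, V j s y = c j • w (t' j + c j ^ 2 * s) (xc j + c j • y) :=
    fun j s y => by rw [hV j, smul_stPull_apply]
  have hVnorm : ∀ j s y, ‖V j s y‖ = c j * ‖w (t' j + c j ^ 2 * s) (xc j + c j • y)‖ :=
    fun j s y => by rw [hVapply, norm_smul, Real.norm_eq_abs, abs_of_pos (hcpos j)]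
  have hVbd : ∀ j, ∀ s ∈ Ioo (A j) (B j), ∀ y, ‖V j s y‖ ≤ 2 := by
    intro j s hs y
    have hσ := hphys j s hs
    rw [hVnorm]
    calc c j * ‖w (t' j + c j ^ 2 * s) (xc j + c j • y)‖ ≤ c j * (2 * ‖w (t' j) (xc j)‖) :=
          mul_le_mul_of_nonneg_left (hwin j _ ⟨hσ.1.le, hσ.2.le⟩ _) (hcpos j).le
      _ = 2 := by rw [← hN, mul_left_comm, hcN, mul_one]
  have hVpast : ∀ j, ∀ s ∈ Ioc (A j) 0, ∀ y, ‖V j s y‖ ≤ 1 + 1 / (((j : ℝ) + 2) + 3) := by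
    intro j s hs y
    have hσ := zoom_time_mem_Ioc (t₀ := t' j) (hcpos j).ne' hs
    rw [hVnorm]
    have h1 := hpast j _ ⟨hσ.1.le, hσ.2⟩ (xc j + c j • y)
    rw [hjcast, ← hN] at h1
    calc c j * ‖w (t' j + c j ^ 2 * s) (xc j + c j • y)‖
        ≤ c j * ((1 + 1 / ((j : ℝ) + 2 + 3)) * N j) := mul_le_mul_of_nonneg_left h1 (hcpos j).le
      _ = 1 + 1 / ((j : ℝ) + 2 + 3) := by
          rw [mul_left_comm, hcN, mul_one]
  have hV0 : ∀ j, ‖V j 0 0‖ = 1 := fun j => by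
    rw [hVnorm, mul_zero, add_zero, smul_zero, add_zero, ← hN, hcN]
  have hVL2 : ∀ j, ∀ s ∈ Ioo (A j) (B j), MemLp (V j s) 2 volume := fun j s hs => by
    rw [show V j s = fun y => c j • w (t' j + c j ^ 2 * s) (xc j + c j • y) from
      funext (hVapply j s)]
    exact BoundedPlanarEnergyRegularity.memLp_two_zoom_slice (hL2w _ (hphysT j s hs)) (xc j)
      (hcpos j).ne'
  have hVK : ∀ j, ∃ K : ℝ≥0∞, K ≠ ⊤ ∧ ∀ s ∈ Ioo (A j) (B j), eLpNorm (V j s) 2 volume ≤ K := by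
    intro j
    refine ⟨ENNReal.ofReal (c j) * (ENNReal.ofReal ((c j ^ 3)⁻¹) ^ (1 / (2 : ℝ≥0∞)).toReal * K₀),
      ENNReal.mul_ne_top ENNReal.ofReal_ne_top (ENNReal.mul_ne_top
        (ENNReal.rpow_ne_top_of_nonneg (by positivity) ENNReal.ofReal_ne_top) hK₀top),
      fun s hs => ?_⟩
    rw [show V j s = fun y => c j • w (t' j + c j ^ 2 * s) (xc j + c j • y) from
      funext (hVapply j s), BoundedPlanarEnergyRegularity.eLpNorm_two_zoom_slice _ _ (hcpos j)]
    gcongr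
    exact hK₀b _ (hphysT j s hs)
  -- ### Step 6: eternal extraction and the eternal mild class (tools)
  obtain ⟨φ, wl, hφ, hwlc, hwlbd, hwlim, hwldiv, hwlmild⟩ :=
    exists_eternal_limit hAtend hBtend hAB hVcl hVbd hVL2 hVK
  obtain ⟨hshift, hsmooth⟩ := eternal_of_oseen hwlc hwlbd hwldiv hwlmild
  refine ⟨wl, hshift, hsmooth, fun s hs y => ?_, hwlbd, ?_⟩
  · -- `‖wl(s, y)‖ ≤ 1` for `s ≤ 0`
    refine le_of_forall_pos_le_add fun ε hε => ?_
    have hAφ : Tendsto (fun m => A (φ m)) atTop atBot := hAtend.comp hφ.tendsto_atTop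
    have e1 : ∀ᶠ m in atTop, A (φ m) < s := hAφ.eventually (eventually_lt_atBot s)
    have e2 : ∀ᶠ m in atTop, 1 / ε ≤ (φ m : ℝ) := by
      have h := (tendsto_natCast_atTop_atTop (R := ℝ)).comp hφ.tendsto_atTop
      exact h.eventually (eventually_ge_atTop (1 / ε))
    refine le_of_tendsto ((hwlim s y).norm) ?_
    filter_upwards [e1, e2] with m h1 h2
    have h3 : 1 / ((φ m : ℝ) + 2 + 3) ≤ ε := by
      rw [div_le_iff₀ (by positivity)]
      have : 1 / ε * ε = 1 := by field_simp
      nlinarith [(φ m).cast_nonneg (α := ℝ)]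
    exact (hVpast (φ m) s ⟨h1, hs⟩ y).trans (by linarith)
  · -- `‖wl(0, 0)‖ = 1`
    have h1 : Tendsto (fun m => ‖V (φ m) 0 0‖) atTop (𝓝 ‖wl 0 0‖) := (hwlim 0 0).norm
    simp_rw [hV0] at h1
    exact tendsto_nhds_unique h1 tendsto_const_nhds

end Summit.NavierStokesRegularity.NavierStokesRegularity.Theorems

end
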